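import Literature.NumberTheory.EllipticCurves.BurungaleCastellaSkinner2025.ProductDivisibilitiesIntegralityProofs
import HarnessLib

/-!
# Gauss content for CONSTANTS over `𝒪_{ℂ_p}⟦T₁⟧⟦T₂⟧` and the two pure-algebra stubs of the O2 lines
# (crux `BDPSelmerLowerDivisibilityAtTwo`, stmt-BirchSwinnertonDyer-24728; route `TwoAdicConverse`, rung S3)

Helper file `--supports stmt-BirchSwinnertonDyer-24728` (seat `bsd-2adic-tower-1` GEN 44, on the pen's standing
invitation RC-547 (B)(ii) «attackable now, 0 print, any idle prover»). THEOREMS ONLY: no definition, no named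
fact, no instance; nothing about any elliptic curve is asserted; BSD is proved for no curve; O2 stays OPEN.

MASTER LEMMA (`forall_norm_coeff_le_of_forall_norm_coeff_mul_le`): over the NON-discrete rank-one valuation
ring `𝒪 = 𝒪_{ℂ_p}` and `A = 𝒪⟦T₁⟧⟦T₂⟧` (index `i` ↦ `coeff i.2 (coeff i.1 F)`): if `F` has a UNIT coefficient
somewhere and every coefficient of `F·H` has norm `≤ ρ`, then so does every coefficient of `H` (Gauss: the
sup-norm is multiplicative when one factor attains sup-norm `1`). Elementary and Weierstrass-free: graded-lex
minimal unit index `i₀` of `F`, `δ < 1` bounding the finitely many `‖F_i‖`, `i ≺ i₀`; `σ = sup ‖H_j‖`; if some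
`‖H_j‖ > ρ` pick `j₁` with `‖H_{j₁}‖ > max(ρ, δσ)`, maximal then `≺`-least below a witness; at `k = i₀ + j₁`
every other term of the double antidiagonal sum is `< ‖H_{j₁}‖` (`≺` is translation-compatible), so
`‖(F·H)_k‖ = ‖H_{j₁}‖ > ρ` ultrametrically — contradiction. Divisibility form (`𝒪` is a valuation ring):
`C(C c) ∣ F·H ⟹ C(C c) ∣ H`. Complementary to the tree's `le_span_of_span_map_C_mul_le_of_hasUnitContent_minus`
(YanZhu2026 proofs: non-constant cyclotomic factors, unit coefficient on the anticyclotomic slice); here the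
factor is a constant and the unit coefficient may sit anywhere (false for non-constant factors: `T₁ ∣ T₁·1`).

THE TWO STUBS (their `Prop`s live in `Cruxes/…/Lines/*.lean`, not importable; proved here UNFOLDED, character
for character, for a one-line `exact` in the line files — scratch-checked, sorries 4 → 3 in each line):
* C2 `SpecialFibreSquareTwo.SaturatedOfUnrDichotomy` (line `special_fibre_square_two`, REGISTERED stub
  `stub_saturatedOfUnrDichotomy`) = `mem_span_of_two_mul_mem_span_of_unrDichotomy`; only the «some coefficient
  is a unit» half of `UnrDichotomyMuZero` is used (the «unit ∨ 2 ∣» half is idle — recorded, not a misstatement).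
* S `TwoVariableGvSqueezeTwo.GaussRigidity₂` (line `two_variable_gv_squeeze_two`, stub `stub_gaussRigidity`, the
  seam of the squeeze) = `span_le_span_of_two_pow_mul_eq_of_residue` (any prime: `…_of_pow_mul_eq_…`):
  `red G ≠ 0` ⟹ `p^m ∣ h` (master lemma) ⟹ `G = C·h₀` with `red h₀` a unit of the domain `𝔽̄_p⟦T₁⟧⟦T₂⟧` ⟹
  `h₀ ∈ Aˣ`. The line card's CAUTION (`red h = 0 ⇏ 2 ∣ h`; general slack false: `C = T₁+2`, `G = T₁+4`) is
  why the slack must be a constant and why a sup/valuation argument is needed.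

References: [folklore] Gauss's lemma for the sup-norm (e.g. Bosch–Güntzer–Remmert, *Non-Archimedean Analysis*,
§5.1.2); line cards `Cruxes/BDPSelmerLowerDivisibilityAtTwo/Lines/{special_fibre_square_two,two_variable_gv_squeeze_two}.md`.
-/

-- D-0017: single-problem summit, the namespace repeats the problem name by design.
set_option linter.dupNamespace false
set_option autoImplicit false

noncomputable section

open scoped Classical

namespace Summit.BirchSwinnertonDyer.BirchSwinnertonDyer.Theorems.TwoAdicBDPGaussContent

open PowerSeries Literature.NumberTheory.EllipticCurves
-- `Finset.antidiagonal` alone resolves to the `Set.IsPWO` antidiagonal of `Data.Finset.MulAntidiagonal`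
open Finset.HasAntidiagonal (antidiagonal mem_antidiagonal)

variable {p : ℕ} [Fact p.Prime]

/-! ## §1. Norm bookkeeping in `𝒪_{ℂ_p}` -/

/-- `c ∣ x` in `𝒪_{ℂ_p}` ⟹ `‖x‖ ≤ ‖c‖`. [folklore] -/
theorem norm_le_norm_of_dvd {c x : PadicComplexInt p} (h : c ∣ x) :
    ‖(x : ℂ_[p])‖ ≤ ‖(c : ℂ_[p])‖ := by
  obtain ⟨q, rfl⟩ := h
  push_cast; rw [norm_mul]
  exact mul_le_of_le_one_right (norm_nonneg _) (norm_coe_padicComplexInt_le_one q)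

/-- A non-unit of `𝒪_{ℂ_p}` has norm `< 1`. [folklore] -/
theorem norm_lt_one_of_not_isUnit {x : PadicComplexInt p} (h : ¬ IsUnit x) : ‖(x : ℂ_[p])‖ < 1 :=
  lt_of_le_of_ne (norm_coe_padicComplexInt_le_one x) fun h1 => h (isUnit_padicComplexInt_iff.mpr h1)

/-- The coefficient of index `(k.1, k.2)` of a product in `𝒪_{ℂ_p}⟦T₁⟧⟦T₂⟧`, as a double antidiagonal sum
in `ℂ_p`. [folklore] -/
theorem coe_coeff_coeff_mul (F H : PowerSeries (PowerSeries (PadicComplexInt p))) (k : ℕ × ℕ) :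
    ((coeff k.2 (coeff k.1 (F * H)) : PadicComplexInt p) : ℂ_[p]) =
      ∑ e ∈ antidiagonal k.1 ×ˢ antidiagonal k.2,
        ((coeff e.2.1 (coeff e.1.1 F) : PadicComplexInt p) : ℂ_[p]) *
          ((coeff e.2.2 (coeff e.1.2 H) : PadicComplexInt p) : ℂ_[p]) := by
  have hval : ∀ x : PadicComplexInt p, (x : ℂ_[p]) = (PadicComplexInt p).subtype x := fun _ => rfl
  rw [hval, coeff_mul, map_sum, map_sum, Finset.sum_product]
  refine Finset.sum_congr rfl fun x _ => ?_
  rw [coeff_mul, map_sum]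
  refine Finset.sum_congr rfl fun y _ => ?_
  rw [map_mul, hval, hval]

/-! ## §2. The master lemma: Gauss content for constants -/

/-- **Graded-lex-minimal unit index.** If some coefficient of `F ∈ 𝒪_{ℂ_p}⟦T₁⟧⟦T₂⟧` is a unit, there is a
unit coefficient of index `i₀` such that all coefficients of graded-lex-smaller index (`|i| < |i₀|`, or
`|i| = |i₀|` and `i.1 < i₀.1` — finitely many) have norm `≤ δ` for some `0 ≤ δ < 1`. [folklore] -/
theorem exists_minimal_isUnit_coeff {F : PowerSeries (PowerSeries (PadicComplexInt p))}
    (hF : ∃ i : ℕ × ℕ, IsUnit (coeff i.2 (coeff i.1 F))) :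
    ∃ (i₀ : ℕ × ℕ) (δ : ℝ), ‖((coeff i₀.2 (coeff i₀.1 F) : PadicComplexInt p) : ℂ_[p])‖ = 1 ∧ 0 ≤ δ ∧ δ < 1 ∧
      ∀ i : ℕ × ℕ, (i.1 + i.2 < i₀.1 + i₀.2 ∨ (i.1 + i.2 = i₀.1 + i₀.2 ∧ i.1 < i₀.1)) →
        ‖((coeff i.2 (coeff i.1 F) : PadicComplexInt p) : ℂ_[p])‖ ≤ δ := by
  obtain ⟨i', hi'⟩ := hF
  set d' : ℕ := i'.1 + i'.2 with hd'
  set S : Finset (ℕ × ℕ) := ((Finset.range (d' + 1)) ×ˢ (Finset.range (d' + 1))).filter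
    (fun i => IsUnit (coeff i.2 (coeff i.1 F))) with hS
  have hi'S : i' ∈ S := by
    simp only [hS, Finset.mem_filter, Finset.mem_product, Finset.mem_range]
    exact ⟨⟨by omega, by omega⟩, hi'⟩
  obtain ⟨i₀, hi₀S, hi₀min⟩ := S.exists_min_image (fun i : ℕ × ℕ => toLex (i.1 + i.2, i.1)) ⟨i', hi'S⟩
  have hi₀ : IsUnit (coeff i₀.2 (coeff i₀.1 F)) := (Finset.mem_filter.mp hi₀S).2
  have hd₀ : i₀.1 + i₀.2 ≤ d' := by
    rcases Prod.Lex.toLex_le_toLex.mp (hi₀min i' hi'S) with h | ⟨h, -⟩ <;> omega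
  have hnu : ∀ i : ℕ × ℕ, (i.1 + i.2 < i₀.1 + i₀.2 ∨ (i.1 + i.2 = i₀.1 + i₀.2 ∧ i.1 < i₀.1)) →
      ¬ IsUnit (coeff i.2 (coeff i.1 F)) := by
    intro i hi hu
    have hiS : i ∈ S := by
      simp only [hS, Finset.mem_filter, Finset.mem_product, Finset.mem_range]
      exact ⟨⟨by omega, by omega⟩, hu⟩
    have h := (Prod.Lex.toLex_le_toLex.mp (hi₀min i hiS))
    simp only at h; omega
  set B : Finset (ℕ × ℕ) := ((Finset.range (d' + 1)) ×ˢ (Finset.range (d' + 1))).filter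
    (fun i => i.1 + i.2 < i₀.1 + i₀.2 ∨ (i.1 + i.2 = i₀.1 + i₀.2 ∧ i.1 < i₀.1)) with hB
  have hmemB : ∀ i : ℕ × ℕ, (i.1 + i.2 < i₀.1 + i₀.2 ∨ (i.1 + i.2 = i₀.1 + i₀.2 ∧ i.1 < i₀.1)) → i ∈ B :=
    fun i hi => by
    simp only [hB, Finset.mem_filter, Finset.mem_product, Finset.mem_range]; exact ⟨⟨by omega, by omega⟩, hi⟩
  refine ⟨i₀, ?_⟩
  rcases B.eq_empty_or_nonempty with hBe | hBne
  · refine ⟨0, isUnit_padicComplexInt_iff.mp hi₀, le_rfl, zero_lt_one, fun i hi => absurd (hmemB i hi) ?_⟩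
    rw [hBe]; exact Finset.notMem_empty _
  · obtain ⟨i₁, hi₁B, hi₁max⟩ := B.exists_max_image
      (fun i : ℕ × ℕ => ‖((coeff i.2 (coeff i.1 F) : PadicComplexInt p) : ℂ_[p])‖) hBne
    have hi₁ : i₁.1 + i₁.2 < i₀.1 + i₀.2 ∨ (i₁.1 + i₁.2 = i₀.1 + i₀.2 ∧ i₁.1 < i₀.1) :=
      (Finset.mem_filter.mp hi₁B).2
    exact ⟨‖((coeff i₁.2 (coeff i₁.1 F) : PadicComplexInt p) : ℂ_[p])‖, isUnit_padicComplexInt_iff.mp hi₀,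
      norm_nonneg _, norm_lt_one_of_not_isUnit (hnu i₁ hi₁), fun i hi => hi₁max i (hmemB i hi)⟩

/-- **Gauss content for constants over `𝒪_{ℂ_p}⟦T₁⟧⟦T₂⟧ (master lemma, norm form).** If `F` has a unit
coefficient at a graded-lex-minimal index `i₀` (smaller coefficients of norm `≤ δ < 1`) and every
coefficient of `F·H` has norm `≤ ρ`, then every coefficient of `H` has norm `≤ ρ`. [folklore] -/
theorem forall_norm_coeff_le_of_minimal {F H : PowerSeries (PowerSeries (PadicComplexInt p))}
    {i₀ : ℕ × ℕ} {δ ρ : ℝ} (h1 : ‖((coeff i₀.2 (coeff i₀.1 F) : PadicComplexInt p) : ℂ_[p])‖ = 1)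
    (hδ0 : 0 ≤ δ) (hδ1 : δ < 1)
    (hδ : ∀ i : ℕ × ℕ, (i.1 + i.2 < i₀.1 + i₀.2 ∨ (i.1 + i.2 = i₀.1 + i₀.2 ∧ i.1 < i₀.1)) →
      ‖((coeff i.2 (coeff i.1 F) : PadicComplexInt p) : ℂ_[p])‖ ≤ δ)
    (hρ : 0 ≤ ρ)
    (hFH : ∀ k : ℕ × ℕ, ‖((coeff k.2 (coeff k.1 (F * H)) : PadicComplexInt p) : ℂ_[p])‖ ≤ ρ) :
    ∀ j : ℕ × ℕ, ‖((coeff j.2 (coeff j.1 H) : PadicComplexInt p) : ℂ_[p])‖ ≤ ρ := by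
  set nF : ℕ × ℕ → ℝ := fun i => ‖((coeff i.2 (coeff i.1 F) : PadicComplexInt p) : ℂ_[p])‖ with hnF
  set nH : ℕ × ℕ → ℝ := fun j => ‖((coeff j.2 (coeff j.1 H) : PadicComplexInt p) : ℂ_[p])‖ with hnH
  have nF_le_one : ∀ i, nF i ≤ 1 := fun i => norm_coe_padicComplexInt_le_one _
  have nH_nonneg : ∀ j, 0 ≤ nH j := fun j => norm_nonneg _
  have nH_le_one : ∀ j, nH j ≤ 1 := fun j => norm_coe_padicComplexInt_le_one _
  have hbdd : BddAbove (Set.range nH) := ⟨1, by rintro _ ⟨j, rfl⟩; exact nH_le_one j⟩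
  by_contra hcon
  push Not at hcon
  obtain ⟨j', hj'⟩ := hcon
  change ρ < nH j' at hj'
  set σ : ℝ := ⨆ j, nH j with hσ
  have hle_σ : ∀ j, nH j ≤ σ := fun j => le_ciSup hbdd j
  have hρσ : ρ < σ := hj'.trans_le (hle_σ j')
  have hσpos : 0 < σ := hρ.trans_lt hρσ
  have hth : max ρ (δ * σ) < σ :=
    max_lt hρσ (by simpa only [one_mul] using mul_lt_mul_of_pos_right hδ1 hσpos)
  obtain ⟨j₂, hj₂⟩ := exists_lt_of_lt_ciSup hth
  change max ρ (δ * σ) < nH j₂ at hj₂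
  -- the finite graded-lex initial segment below `j₂`
  set d₂ : ℕ := j₂.1 + j₂.2 with hd₂
  set T : Finset (ℕ × ℕ) := ((Finset.range (d₂ + 1)) ×ˢ (Finset.range (d₂ + 1))).filter
    (fun j => j.1 + j.2 < d₂ ∨ (j.1 + j.2 = d₂ ∧ j.1 ≤ j₂.1)) with hT
  have hmemT : ∀ j : ℕ × ℕ, (j.1 + j.2 < d₂ ∨ (j.1 + j.2 = d₂ ∧ j.1 ≤ j₂.1)) ↔ j ∈ T := fun j => by
    simp only [hT, Finset.mem_filter, Finset.mem_product, Finset.mem_range]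
    exact ⟨fun hj => ⟨⟨by omega, by omega⟩, hj⟩, fun hj => hj.2⟩
  have hj₂T : j₂ ∈ T := (hmemT j₂).1 (Or.inr ⟨rfl, le_rfl⟩)
  -- a maximiser of `nH` over `T`, then the `≺`-least maximiser
  obtain ⟨j₃, hj₃T, hj₃max⟩ := T.exists_max_image nH ⟨j₂, hj₂T⟩
  set T' : Finset (ℕ × ℕ) := T.filter (fun j => nH j = nH j₃) with hT'
  obtain ⟨j₁, hj₁T', hj₁min⟩ := T'.exists_min_image (fun j : ℕ × ℕ => toLex (j.1 + j.2, j.1))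
    ⟨j₃, Finset.mem_filter.mpr ⟨hj₃T, rfl⟩⟩
  have hj₁T : j₁ ∈ T := (Finset.mem_filter.mp hj₁T').1
  have hj₁eq : nH j₁ = nH j₃ := (Finset.mem_filter.mp hj₁T').2
  obtain ⟨M, hM⟩ : ∃ M : ℝ, M = nH j₁ := ⟨_, rfl⟩
  have hMgt : max ρ (δ * σ) < M := by
    rw [hM, hj₁eq]; exact hj₂.trans_le (hj₃max j₂ hj₂T)
  have hρM : ρ < M := (le_max_left _ _).trans_lt hMgt
  have hδσM : δ * σ < M := (le_max_right _ _).trans_lt hMgt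
  have hMpos : 0 < M := hρ.trans_lt hρM
  have hj₁le : j₁.1 + j₁.2 < d₂ ∨ (j₁.1 + j₁.2 = d₂ ∧ j₁.1 ≤ j₂.1) := (hmemT j₁).2 hj₁T
  -- (F3): strictly `≺`-smaller indices than `j₁` carry strictly smaller coefficients
  have hlt : ∀ j : ℕ × ℕ, (j.1 + j.2 < j₁.1 + j₁.2 ∨ (j.1 + j.2 = j₁.1 + j₁.2 ∧ j.1 < j₁.1)) → nH j < M := by
    intro j hj
    have hjT : j ∈ T := (hmemT j).1 (by omega)
    have hjle : nH j ≤ M := by rw [hM, hj₁eq]; exact hj₃max j hjT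
    refine lt_of_le_of_ne hjle fun hjeq => ?_
    have hjT' : j ∈ T' := by
      simp only [hT', Finset.mem_filter]
      exact ⟨hjT, by rw [hjeq, hM, hj₁eq]⟩
    have h := Prod.Lex.toLex_le_toLex.mp (hj₁min j hjT')
    simp only at h; omega
  -- the index `k = i₀ + j₁` and the product coefficient there
  set k : ℕ × ℕ := (i₀.1 + j₁.1, i₀.2 + j₁.2) with hk
  set P : Finset ((ℕ × ℕ) × (ℕ × ℕ)) := antidiagonal k.1 ×ˢ antidiagonal k.2 with hP
  set tC : (ℕ × ℕ) × (ℕ × ℕ) → ℂ_[p] := fun e =>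
    ((coeff e.2.1 (coeff e.1.1 F) : PadicComplexInt p) : ℂ_[p]) *
      ((coeff e.2.2 (coeff e.1.2 H) : PadicComplexInt p) : ℂ_[p]) with htC
  have hsum : ((coeff k.2 (coeff k.1 (F * H)) : PadicComplexInt p) : ℂ_[p]) = ∑ e ∈ P, tC e :=
    coe_coeff_coeff_mul F H k
  set e₀ : (ℕ × ℕ) × (ℕ × ℕ) := ((i₀.1, j₁.1), (i₀.2, j₁.2)) with he₀
  have he₀P : e₀ ∈ P := by
    simp only [hP, he₀, hk, Finset.mem_product, mem_antidiagonal, and_self]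
  have hnorm_e₀ : ‖tC e₀‖ = M := by
    simp only [htC, he₀, norm_mul]
    change nF i₀ * nH j₁ = M
    rw [show nF i₀ = 1 from h1, one_mul, hM]
  -- every other term is strictly smaller than `M`
  have hother : ∀ e ∈ P.erase e₀, ‖tC e‖ < M := by
    intro e he
    obtain ⟨hne, heP⟩ := Finset.mem_erase.mp he
    simp only [hP, hk, Finset.mem_product, mem_antidiagonal] at heP
    obtain ⟨h₁, h₂⟩ := heP
    rw [show ‖tC e‖ = nF (e.1.1, e.2.1) * nH (e.1.2, e.2.2) by simp only [htC, hnF, hnH, norm_mul]]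
    -- trichotomy: `i = i₀` (excluded), `i ≺ i₀`, or `j ≺ j₁`
    by_cases hi : e.1.1 = i₀.1 ∧ e.2.1 = i₀.2
    · refine absurd ?_ hne
      rw [he₀]
      exact Prod.ext (Prod.ext hi.1 (show e.1.2 = j₁.1 by omega)) (Prod.ext hi.2 (show e.2.2 = j₁.2 by omega))
    · rcases (show (e.1.1 + e.2.1 < i₀.1 + i₀.2 ∨ (e.1.1 + e.2.1 = i₀.1 + i₀.2 ∧ e.1.1 < i₀.1)) ∨
          (e.1.2 + e.2.2 < j₁.1 + j₁.2 ∨ (e.1.2 + e.2.2 = j₁.1 + j₁.2 ∧ e.1.2 < j₁.1)) by omega)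
        with hi' | hj'
      · -- `i ≺ i₀`: `‖F_i‖ ≤ δ`, `‖H_j‖ ≤ σ`
        calc nF (e.1.1, e.2.1) * nH (e.1.2, e.2.2) ≤ δ * σ :=
            mul_le_mul (hδ (e.1.1, e.2.1) hi') (hle_σ _) (nH_nonneg _) hδ0
          _ < M := hδσM
      · -- `j ≺ j₁`: `‖F_i‖ ≤ 1`, `‖H_j‖ < M`
        calc nF (e.1.1, e.2.1) * nH (e.1.2, e.2.2) ≤ 1 * nH (e.1.2, e.2.2) :=
            mul_le_mul_of_nonneg_right (nF_le_one _) (nH_nonneg _)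
          _ = nH (e.1.2, e.2.2) := one_mul _
          _ < M := hlt (e.1.2, e.2.2) hj'
  have hrest : ‖∑ e ∈ P.erase e₀, tC e‖ < M := by
    rcases (P.erase e₀).eq_empty_or_nonempty with hPe | hPne
    · rw [hPe, Finset.sum_empty, norm_zero]; exact hMpos
    · obtain ⟨e, he, hle⟩ := IsUltrametricDist.exists_norm_finsetSum_le_of_nonempty hPne tC
      exact hle.trans_lt (hother e he)
  -- ultrametric: the coefficient at `k` has norm exactly `M`
  have hnormk : ‖((coeff k.2 (coeff k.1 (F * H)) : PadicComplexInt p) : ℂ_[p])‖ = M := by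
    rw [hsum, ← Finset.add_sum_erase P tC he₀P,
      IsUltrametricDist.norm_add_eq_max_of_norm_ne_norm (by rw [hnorm_e₀]; exact hrest.ne'), hnorm_e₀,
      max_eq_left hrest.le]
  exact absurd (hFH k) (by rw [hnormk]; exact not_le.mpr hρM)

/-- **Gauss content for constants over `𝒪_{ℂ_p}⟦T₁⟧⟦T₂⟧ (norm form).** If SOME coefficient of `F` is a unit
and every coefficient of `F·H` has norm `≤ ρ` (`ρ ≥ 0`), then every coefficient of `H` has norm `≤ ρ`.
[folklore] -/
theorem forall_norm_coeff_le_of_forall_norm_coeff_mul_le {F H : PowerSeries (PowerSeries (PadicComplexInt p))}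
    (hF : ∃ i : ℕ × ℕ, IsUnit (coeff i.2 (coeff i.1 F))) {ρ : ℝ} (hρ : 0 ≤ ρ)
    (hFH : ∀ k : ℕ × ℕ, ‖((coeff k.2 (coeff k.1 (F * H)) : PadicComplexInt p) : ℂ_[p])‖ ≤ ρ) :
    ∀ j : ℕ × ℕ, ‖((coeff j.2 (coeff j.1 H) : PadicComplexInt p) : ℂ_[p])‖ ≤ ρ := by
  obtain ⟨i₀, δ, h1, hδ0, hδ1, hδ⟩ := exists_minimal_isUnit_coeff hF
  exact forall_norm_coeff_le_of_minimal h1 hδ0 hδ1 hδ hρ hFH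

/-- **Gauss content for constants (divisibility form).** If some coefficient of `F ∈ 𝒪_{ℂ_p}⟦T₁⟧⟦T₂⟧` is a
unit and `c ∈ 𝒪_{ℂ_p}` divides every coefficient of `F·H`, then `c` divides every coefficient of `H`.
[folklore] -/
theorem forall_dvd_coeff_of_forall_dvd_coeff_mul {F H : PowerSeries (PowerSeries (PadicComplexInt p))}
    (hF : ∃ i : ℕ × ℕ, IsUnit (coeff i.2 (coeff i.1 F))) {c : PadicComplexInt p}
    (hFH : ∀ k : ℕ × ℕ, c ∣ coeff k.2 (coeff k.1 (F * H))) :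
    ∀ j : ℕ × ℕ, c ∣ coeff j.2 (coeff j.1 H) := fun j =>
  padicComplexInt_dvd_of_norm_le (forall_norm_coeff_le_of_forall_norm_coeff_mul_le hF (norm_nonneg _)
    (fun k => norm_le_norm_of_dvd (hFH k)) j)

/-! ## §3. Constants `C (C c)` of `𝒪_{ℂ_p}⟦T₁⟧⟦T₂⟧`: divisibility is coefficientwise -/

/-- `C(C c) ∣ H` iff `c` divides every coefficient of `H`. [folklore] -/
theorem C_C_dvd_iff_forall_dvd_coeff {c : PadicComplexInt p} {H : PowerSeries (PowerSeries (PadicComplexInt p))} :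
    PowerSeries.C (PowerSeries.C c) ∣ H ↔ ∀ j : ℕ × ℕ, c ∣ coeff j.2 (coeff j.1 H) := by
  constructor
  · rintro ⟨Q, rfl⟩ j
    rw [coeff_C_mul, coeff_C_mul]
    exact Dvd.intro _ rfl
  · intro h
    choose q hq using fun j : ℕ × ℕ => h j
    refine ⟨PowerSeries.mk fun n => PowerSeries.mk fun m => q (n, m), ?_⟩
    ext n m : 2
    simp only [coeff_C_mul, coeff_mk]
    exact hq (n, m)

/-- **Gauss content for constants (element form):** if some coefficient of `F` is a unit then
`C(C c) ∣ F·H ⟹ C(C c) ∣ H` in `𝒪_{ℂ_p}⟦T₁⟧⟦T₂⟧`. [folklore] -/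
theorem C_C_dvd_of_C_C_dvd_mul_of_exists_isUnit_coeff {F H : PowerSeries (PowerSeries (PadicComplexInt p))}
    (hF : ∃ i : ℕ × ℕ, IsUnit (coeff i.2 (coeff i.1 F))) {c : PadicComplexInt p}
    (h : PowerSeries.C (PowerSeries.C c) ∣ F * H) : PowerSeries.C (PowerSeries.C c) ∣ H :=
  C_C_dvd_iff_forall_dvd_coeff.mpr (forall_dvd_coeff_of_forall_dvd_coeff_mul hF (C_C_dvd_iff_forall_dvd_coeff.mp h))

/-- `(p^m)` as a constant of `𝒪_{ℂ_p}⟦T₁⟧⟦T₂⟧`: `(p : A)^m = C(C (p^m))`. [folklore] -/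
theorem natCast_pow_eq_C_C (m : ℕ) :
    ((p : ℕ) : PowerSeries (PowerSeries (PadicComplexInt p))) ^ m =
      PowerSeries.C (PowerSeries.C (((p : ℕ) : PadicComplexInt p) ^ m)) := by
  rw [map_pow, map_pow, map_natCast, map_natCast]

/-- `C(C c) ≠ 0` for `c ≠ 0`. [folklore] -/
theorem C_C_ne_zero {c : PadicComplexInt p} (hc : c ≠ 0) :
    (PowerSeries.C (PowerSeries.C c) : PowerSeries (PowerSeries (PadicComplexInt p))) ≠ 0 := fun h =>
  hc (PowerSeries.C_injective (PowerSeries.C_injective (by rw [h, map_zero, map_zero])))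

/-! ## §4. Saturation by constants: `c·X ∈ (F) ⟹ X ∈ (F)` when `F` has a unit coefficient -/

/-- **`(F)` is saturated for every nonzero constant** when some coefficient of `F` is a unit:
`C(C c)·X ∈ (F)`, `c ≠ 0` ⟹ `X ∈ (F)`. [folklore] -/
theorem mem_span_of_C_C_mul_mem_span {F X : PowerSeries (PowerSeries (PadicComplexInt p))}
    (hF : ∃ i : ℕ × ℕ, IsUnit (coeff i.2 (coeff i.1 F))) {c : PadicComplexInt p} (hc : c ≠ 0)
    (hX : PowerSeries.C (PowerSeries.C c) * X ∈ Ideal.span {F}) : X ∈ Ideal.span {F} := by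
  obtain ⟨Y, hY⟩ := Ideal.mem_span_singleton'.mp hX
  -- `C(C c) ∣ F·Y`, hence `C(C c) ∣ Y`
  have hdvd : PowerSeries.C (PowerSeries.C c) ∣ F * Y := ⟨X, by rw [mul_comm F Y, hY]⟩
  obtain ⟨Y', rfl⟩ := C_C_dvd_of_C_C_dvd_mul_of_exists_isUnit_coeff hF hdvd
  refine Ideal.mem_span_singleton'.mpr ⟨Y', mul_left_cancel₀ (C_C_ne_zero hc) ?_⟩
  rw [← hY]; ring

/-- Power form: `(p : A)^m · X ∈ (F)` ⟹ `X ∈ (F)` when some coefficient of `F` is a unit. [folklore] -/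
theorem mem_span_of_natCast_pow_mul_mem_span {F X : PowerSeries (PowerSeries (PadicComplexInt p))}
    (hF : ∃ i : ℕ × ℕ, IsUnit (coeff i.2 (coeff i.1 F))) {m : ℕ}
    (hX : ((p : ℕ) : PowerSeries (PowerSeries (PadicComplexInt p))) ^ m * X ∈ Ideal.span {F}) :
    X ∈ Ideal.span {F} := by
  rw [natCast_pow_eq_C_C] at hX
  exact mem_span_of_C_C_mul_mem_span hF (pow_ne_zero m natCast_prime_padicComplexInt_ne_zero) hX

/-- **Stub C2 of line `special_fibre_square_two` (`SpecialFibreSquareTwo.SaturatedOfUnrDichotomy`), proved, in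
UNFOLDED form character for character** (`Rcpt`, `UnrDichotomyMuZero G₀` = the conjunction below): if every
coefficient of `G₀ ∈ 𝒪_{ℂ₂}⟦T₁⟧⟦T₂⟧` is a unit or divisible by `2` and some coefficient is a unit, then
`2·X ∈ (G₀) ⟹ X ∈ (G₀)`; only the second conjunct is used. Drop-in: `theorem stub_saturatedOfUnrDichotomy :
SaturatedOfUnrDichotomy := fun G₀ hG₀ X hX => …mem_span_of_two_mul_mem_span_of_unrDichotomy G₀ hG₀ X hX`. [folklore] -/
theorem mem_span_of_two_mul_mem_span_of_unrDichotomy (G₀ : PowerSeries (PowerSeries (PadicComplexInt 2)))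
    (hG₀ : (∀ n m : ℕ, IsUnit (PowerSeries.coeff m (PowerSeries.coeff n G₀)) ∨
        (2 : PadicComplexInt 2) ∣ PowerSeries.coeff m (PowerSeries.coeff n G₀)) ∧
      ∃ n m : ℕ, IsUnit (PowerSeries.coeff m (PowerSeries.coeff n G₀)))
    (X : PowerSeries (PowerSeries (PadicComplexInt 2))) (hX : 2 * X ∈ Ideal.span {G₀}) :
    X ∈ Ideal.span {G₀} := by
  obtain ⟨n, m, hnm⟩ := hG₀.2
  refine mem_span_of_natCast_pow_mul_mem_span (p := 2) (m := 1) ⟨(n, m), hnm⟩ ?_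
  rwa [pow_one, Nat.cast_ofNat]

/-! ## §5. Gauss rigidity: `p^m·G = C·h`, `red C ≠ 0`, `(red G) = (red C)` ⟹ `(C) ⊆ (G)` -/

/-- A series over `𝒪_{ℂ_p}⟦T₁⟧⟦T₂⟧` whose coefficientwise reduction is a UNIT of `𝔽̄_p⟦T₁⟧⟦T₂⟧` is a unit
(units of nested power series = unit constant term; units of `𝒪_{ℂ_p}` = nonzero residue). [folklore] -/
theorem isUnit_of_isUnit_map_map_residue {h : PowerSeries (PowerSeries (PadicComplexInt p))}
    (hu : IsUnit (PowerSeries.map (PowerSeries.map (IsLocalRing.residue (PadicComplexInt p))) h)) : IsUnit h := by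
  rw [PowerSeries.isUnit_iff_constantCoeff, PowerSeries.isUnit_iff_constantCoeff,
    ← coeff_zero_eq_constantCoeff_apply, ← coeff_zero_eq_constantCoeff_apply] at hu ⊢
  rw [coeff_map, coeff_map, ← coeff_map, coeff_map] at hu
  exact (IsLocalRing.residue_ne_zero_iff_isUnit _).mp hu.ne_zero

/-- Nonzero reduction gives a unit coefficient (residue currency → unit-content currency). [folklore] -/
theorem exists_isUnit_coeff_of_map_map_residue_ne_zero {G : PowerSeries (PowerSeries (PadicComplexInt p))}
    (hG : PowerSeries.map (PowerSeries.map (IsLocalRing.residue (PadicComplexInt p))) G ≠ 0) :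
    ∃ i : ℕ × ℕ, IsUnit (coeff i.2 (coeff i.1 G)) := by
  by_contra hcon
  push Not at hcon
  refine hG (PowerSeries.ext fun n => PowerSeries.ext fun m => ?_)
  rw [coeff_map, coeff_map, map_zero, map_zero, IsLocalRing.residue_eq_zero_iff]
  exact hcon (n, m)

/-- **Gauss rigidity over `𝒪_{ℂ_p}⟦T₁⟧⟦T₂⟧ (general prime).** If `p^m·G = C·h`, `red C ≠ 0` and
`(red G) = (red C)` as ideals of `𝔽̄_p⟦T₁⟧⟦T₂⟧` (`red` = coefficientwise reduction modulo the maximal ideal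
of `𝒪_{ℂ_p}`), then `(C) ⊆ (G)`. Proof: `C` has a unit coefficient and `p^m` divides every coefficient of
`C·h = p^m·G`, so `p^m ∣ h` (Gauss content for constants), `G = C·h₀`, and `red C = w·red G = w·red C·red h₀`
in the domain `𝔽̄_p⟦T₁⟧⟦T₂⟧` makes `red h₀`, hence `h₀`, a unit. [folklore] -/
theorem span_le_span_of_pow_mul_eq_of_residue (C G h : PowerSeries (PowerSeries (PadicComplexInt p))) (m : ℕ)
    (hCh : ((p : ℕ) : PowerSeries (PowerSeries (PadicComplexInt p))) ^ m * G = C * h)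
    (hC : PowerSeries.map (PowerSeries.map (IsLocalRing.residue (PadicComplexInt p))) C ≠ 0)
    (hGC : Ideal.span {PowerSeries.map (PowerSeries.map (IsLocalRing.residue (PadicComplexInt p))) G} =
      Ideal.span {PowerSeries.map (PowerSeries.map (IsLocalRing.residue (PadicComplexInt p))) C}) :
    Ideal.span {C} ≤ Ideal.span {G} := by
  set red := PowerSeries.map (PowerSeries.map (IsLocalRing.residue (PadicComplexInt p))) with hred
  have hCu : ∃ i : ℕ × ℕ, IsUnit (coeff i.2 (coeff i.1 C)) := exists_isUnit_coeff_of_map_map_residue_ne_zero hC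
  have hdvd : PowerSeries.C (PowerSeries.C (((p : ℕ) : PadicComplexInt p) ^ m)) ∣ C * h :=
    ⟨G, by rw [← hCh, natCast_pow_eq_C_C]⟩
  obtain ⟨h₀, rfl⟩ := C_C_dvd_of_C_C_dvd_mul_of_exists_isUnit_coeff hCu hdvd
  have hG : G = C * h₀ := by
    refine mul_left_cancel₀ (C_C_ne_zero (pow_ne_zero m (natCast_prime_padicComplexInt_ne_zero (p := p)))) ?_
    rw [← natCast_pow_eq_C_C, hCh, natCast_pow_eq_C_C]; ring
  -- `red h₀` is a unit of the domain `𝔽̄_p⟦T₁⟧⟦T₂⟧`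
  have hw : red C ∈ Ideal.span {red G} := by rw [hGC]; exact Ideal.mem_span_singleton_self _
  obtain ⟨w, hw⟩ := Ideal.mem_span_singleton'.mp hw
  have hGred : red G = red C * red h₀ := by rw [hG, map_mul]
  have hunit : IsUnit (red h₀) := by
    have h1 : red C * (w * red h₀ - 1) = 0 := by
      rw [mul_sub, mul_one, sub_eq_zero, ← mul_assoc, mul_comm (red C) w, mul_assoc, ← hGred, hw]
    rcases mul_eq_zero.mp h1 with h0 | h0
    · exact absurd h0 hC
    · exact isUnit_iff_exists_inv'.mpr ⟨w, sub_eq_zero.mp h0⟩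
  obtain ⟨u, hu⟩ := isUnit_of_isUnit_map_map_residue hunit
  refine Ideal.span_singleton_le_span_singleton.mpr ⟨↑u⁻¹, ?_⟩
  rw [hG, ← hu, mul_assoc, Units.mul_inv, mul_one]

/-- **Stub S of line `two_variable_gv_squeeze_two` (`TwoVariableGvSqueezeTwo.GaussRigidity₂`), proved, in
UNFOLDED form character for character** (`A₂`, `red₂ = map (map residue)` unfolded): `2^m·G = C·h`,
`red₂ C ≠ 0`, `(red₂ G) = (red₂ C)` ⟹ `(C) ⊆ (G)`. Drop-in: `theorem stub_gaussRigidity : GaussRigidity₂ :=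
fun C G h m h₁ h₂ h₃ => …span_le_span_of_two_pow_mul_eq_of_residue C G h m h₁ h₂ h₃`. [folklore] -/
theorem span_le_span_of_two_pow_mul_eq_of_residue (C G h : PowerSeries (PowerSeries (PadicComplexInt 2)))
    (m : ℕ) (hCh : (2 : PowerSeries (PowerSeries (PadicComplexInt 2))) ^ m * G = C * h)
    (hC : PowerSeries.map (PowerSeries.map (IsLocalRing.residue (PadicComplexInt 2))) C ≠ 0)
    (hGC : Ideal.span {PowerSeries.map (PowerSeries.map (IsLocalRing.residue (PadicComplexInt 2))) G} =
      Ideal.span {PowerSeries.map (PowerSeries.map (IsLocalRing.residue (PadicComplexInt 2))) C}) :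
    Ideal.span {C} ≤ Ideal.span {G} :=
  span_le_span_of_pow_mul_eq_of_residue C G h m (by rw [Nat.cast_ofNat]; exact hCh) hC hGC

end Summit.BirchSwinnertonDyer.BirchSwinnertonDyer.Theorems.TwoAdicBDPGaussContent

end
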